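import Literature.MathematicalPhysics.QuantumLattice.AnionOrderingFolding
import Literature.MathematicalPhysics.QuantumLattice.CuprateAxialOrbitalDownfold

/-!
# The ortho-II chain-order zone folding of the cuprate plane band (Bascones–Rice model)

Exact one-body content of the planar model used for ortho-II YBa₂Cu₃O₆.₅ in
[BasconesEtAl2005, Eqs. (1)–(3), (5), (6)]: the `t–t′–t″` plane band
`ε(k) = −2t(cos kₓ + cos k_y) + 4t′ cos kₓ cos k_y − 2t″(cos 2kₓ + cos 2k_y)` (their Eq. (1) without
the chemical potential; literally the tree's `CuprateFourOrbital.pavariniBand`), an external potential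
`V` on every SECOND column of plane sites (the alternation of full and empty CuO chains doubles the cell
along `a`), and an additive bilayer term `± t⊥(k)`.  The column potential couples `k` to
`k + Q`, `Q = (π, 0)`, with amplitude `V/2`, so in the reduced zone `kₓ ∈ (−π/2, π/2)` the problem at
each `k` is the real symmetric two-level problem `hybBloch (ε(k)) (ε(k+Q)) (V/2)` of
`AnionOrderingFolding` (lit-2), shifted on the diagonal by `−μ ± t⊥(k)`.  Every declaration below is a
definition with a body or a proved theorem; there are no named facts and no numbers.

## What is proved
* `band_add_pi`: the translate `ε(kₓ + π, k_y)`; centre `foldCentre = −2t cos k_y − 2t″(cos 2kₓ + cos 2k_y)`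
  and half-difference `foldHalfDiff = −2cos kₓ (t − 2t′ cos k_y)` of the pair `ε(k), ε(k+Q)`
  (`hybMean_fold`, `hybHalfDiff_fold`), radius `foldRadius = √(4cos²kₓ (t − 2t′cos k_y)² + V²/4)`
  (`hybRadius_fold`).
* Their Eq. (2): the folded bands `bandHi/bandLo = foldCentre − μ + s ± foldRadius` (`s` standing for
  `± t⊥(k)`) ARE the two hybridised levels of the shifted two-level problem (`bandHi_eq_hybUpper`,
  `bandLo_eq_hybLower`, `ortho_charpoly_root_iff`, eigen-equations `orthoBloch_mulVec_hi/lo`).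
* The inter-branch splitting `bandHi − bandLo = 2·foldRadius` contains neither `t⊥` nor `t″` nor `μ`
  ("independent of the bilayer band", p. 2), is `≥ |V|` everywhere (`splitting_ge`) and EQUALS `|V|`
  on the whole reduced-zone boundary `cos kₓ = 0`, i.e. on the X–S line `kₓ = ±π/2`
  (`splitting_zone_boundary`, `splitting_XS`) — "a gap opening at the new Brillouin zone boundary
  kₓ = ±π/2" (abstract), "the onset for absorption is ω = V … states with kₓ = ±π/2" (p. 3); it is
  largest at `kₓ = 0` for fixed `k_y` (`foldRadius_le_axis`); without chain order (`V = 0`) the branches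
  are the bare `max/min (ε(k), ε(k+Q))` and touch on X–S (`bandHi_noOrder`, `splitting_noOrder_XS`).
* The bilayer splitting of either folded branch is `2t⊥`, `V`-independent (`bilayer_splitting_hi/lo`);
  the centre of the folded pair is `V`-independent (`bandHi_add_bandLo`).
* Their Eq. (3): the d-wave gap in the folded basis `Δ(k) = ½Δ₀(g(k) cos kₓ − cos k_y)` with
  `g = 2cos kₓ(t − 2t′cos k_y)/foldRadius`; `|g| ≤ 1` (`abs_gapFactor_le_one`), `g = 0` on X–S
  (`gapFactor_zone_boundary`), and for `V = 0` one recovers `½Δ₀(cos kₓ − cos k_y)` on the branch where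
  `2cos kₓ(t − 2t′cos k_y) > 0` and the `k+Q` form `½Δ₀(cos(kₓ+π) − cos k_y)` on the other
  (`foldGap_noOrder_pos/neg`).
* Their Eqs. (5), (6): the interband optical matrix elements `M_aa`, `M_bb`; both vanish when `V = 0`
  ("should be absent in non-Ortho II phases"), `M_bb = 0` on X–S while `M_aa = 4(t − 2t′cos k_y)²`
  there ("M_aa is finite and large at kₓ = ±π/2 … M_bb vanishes at kₓ = ±π/2", p. 3).
* Eq. (2) with the paper's `k`-dependent column potential `V(k)` (p. 2: "V and t⊥(k) are only slightly
  k-dependent … we set them constant"), in the instance `V(k_y) = V − 4δ cos k_y` of a column differing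
  from its neighbour in on-site energy (`V`) AND in `b`-axis hopping (`2δ`): coupling
  `siteBondCoupling V δ k_y = V/2 − 2δ cos k_y`, X–S gap `|V − 4δ cos k_y|` (`splitting_XS_siteBond`),
  between `|V| − 4|δ|` and `|V| + 4|δ|`, constant along X–S iff `Vδ = 0` (`splitting_XS_siteBond_varies`).  The located full-potential value of the
  X–S splitting ("∼ 17 ± 2 meV", [CarringtonYelland2007, p. 2]) versus the TB-LMTO-ASA "120–160 meV"
  of [BasconesEtAl2005, p. 2] is DATA and lives in the cell's REFVALS files, not here.

References: E. Bascones, T. M. Rice, A. O. Shorikov, A. V. Lukoyanov, V. I. Anisimov, *Optical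
conductivity of ortho-II YBa₂Cu₃O₆.₅*, Phys. Rev. B 71 (2005) 012505, arXiv:cond-mat/0406405,
Eqs. (1)–(3), (5), (6) and pp. 1–3 · A. Carrington, E. A. Yelland, *Band-structure calculations of
Fermi-surface pockets in ortho-II YBa₂Cu₃O₆.₅*, Phys. Rev. B 76 (2007) 140508(R), arXiv:0706.4418,
p. 2 (band folding of the O-I bands into the O-II zone; the X–S splitting).  AI-produced formalisation
(H21, cell hubbard-downfold, seat lit-1, 2026-08-27); no facts, no axioms beyond Mathlib's, no `sorry`.
-/

noncomputable section

namespace Literature.MathematicalPhysics.QuantumLattice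

namespace OrthoIIFold

open Real Matrix CuprateFourOrbital

/-! ## §1 The plane band, its `(π, 0)` translate, centre, half-difference and radius -/

/-- Centre of the folded pair `(ε(k) + ε(k+Q))/2 = −2t cos k_y − 2t″(cos 2kₓ + cos 2k_y)`: the part of
Eq. (2) in front of the square root (without `−μ ± t⊥`). [cite: BasconesEtAl2005, Eq. (2)] -/
def foldCentre (t t'' kx ky : ℝ) : ℝ :=
  -2 * t * cos ky - 2 * t'' * (cos (2 * kx) + cos (2 * ky))

/-- Half-difference of the folded pair `(ε(k) − ε(k+Q))/2 = −2cos kₓ (t − 2t′ cos k_y)`.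
[cite: BasconesEtAl2005, Eq. (2)] -/
def foldHalfDiff (t t' kx ky : ℝ) : ℝ := -(2 * cos kx * (t - 2 * t' * cos ky))

/-- Bascones' square root `√(4cos²kₓ (t − 2t′ cos k_y)² + V²/4)`. [cite: BasconesEtAl2005, Eq. (2)] -/
def foldRadius (t t' V kx ky : ℝ) : ℝ :=
  Real.sqrt (4 * cos kx ^ 2 * (t - 2 * t' * cos ky) ^ 2 + V ^ 2 / 4)

/-- Unfolding of `foldCentre`. [cite: BasconesEtAl2005, Eq. (2)] -/
theorem foldCentre_def (t t'' kx ky : ℝ) :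
    foldCentre t t'' kx ky = -2 * t * cos ky - 2 * t'' * (cos (2 * kx) + cos (2 * ky)) := rfl

/-- Unfolding of `foldHalfDiff`. [cite: BasconesEtAl2005, Eq. (2)] -/
theorem foldHalfDiff_def (t t' kx ky : ℝ) :
    foldHalfDiff t t' kx ky = -(2 * cos kx * (t - 2 * t' * cos ky)) := rfl

/-- Unfolding of `foldRadius`. [cite: BasconesEtAl2005, Eq. (2)] -/
theorem foldRadius_def (t t' V kx ky : ℝ) :
    foldRadius t t' V kx ky = Real.sqrt (4 * cos kx ^ 2 * (t - 2 * t' * cos ky) ^ 2 + V ^ 2 / 4) := rfl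

/-- **The `Q = (π, 0)` translate of the plane band**:
`ε(kₓ + π, k_y) = 2t cos kₓ − 2t cos k_y − 4t′ cos kₓ cos k_y − 2t″(cos 2kₓ + cos 2k_y)` (the `cos kₓ`
harmonics flip sign, the `cos 2kₓ` harmonic does not). [cite: CarringtonYelland2007, p. 2 (folding of the
O-I bands into the O-II zone)] -/
theorem band_add_pi (t t' t'' kx ky : ℝ) :
    pavariniBand t t' t'' (kx + π) ky
      = 2 * t * cos kx - 2 * t * cos ky - 4 * t' * (cos kx * cos ky)
          - 2 * t'' * (cos (2 * kx) + cos (2 * ky)) := by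
  have h2 : cos (2 * (kx + π)) = cos (2 * kx) := by
    rw [show 2 * (kx + π) = 2 * kx + 2 * π by ring, Real.cos_add_two_pi]
  unfold pavariniBand
  rw [Real.cos_add_pi, h2]
  ring

/-- `ε(k) = centre + half-difference`. [cite: BasconesEtAl2005, Eqs. (1)–(2)] -/
theorem band_eq_centre_add_halfDiff (t t' t'' kx ky : ℝ) :
    pavariniBand t t' t'' kx ky = foldCentre t t'' kx ky + foldHalfDiff t t' kx ky := by
  unfold pavariniBand foldCentre foldHalfDiff
  ring

/-- `ε(k+Q) = centre − half-difference`. [cite: BasconesEtAl2005, Eqs. (1)–(2)] -/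
theorem band_add_pi_eq_centre_sub_halfDiff (t t' t'' kx ky : ℝ) :
    pavariniBand t t' t'' (kx + π) ky = foldCentre t t'' kx ky - foldHalfDiff t t' kx ky := by
  rw [band_add_pi]
  unfold foldCentre foldHalfDiff
  ring

/-- On the reduced-zone boundary `cos kₓ = 0` the two bare levels coincide: `ε(k+Q) = ε(k)`.
[cite: BasconesEtAl2005, p. 2 ("Without the doubling of the unit cell both band pairs would be degenerate")] -/
theorem band_add_pi_zone_boundary (t t' t'' kx ky : ℝ) (h : cos kx = 0) :
    pavariniBand t t' t'' (kx + π) ky = pavariniBand t t' t'' kx ky := by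
  rw [band_add_pi_eq_centre_sub_halfDiff, band_eq_centre_add_halfDiff, foldHalfDiff, h]
  ring

/-- The two-level MEAN of the folded pair is `foldCentre`. [cite: BasconesEtAl2005, Eq. (2)] -/
theorem hybMean_fold (t t' t'' kx ky : ℝ) :
    hybMean (pavariniBand t t' t'' kx ky) (pavariniBand t t' t'' (kx + π) ky) = foldCentre t t'' kx ky := by
  rw [hybMean_def, band_eq_centre_add_halfDiff, band_add_pi_eq_centre_sub_halfDiff]
  ring

/-- The two-level HALF-DIFFERENCE of the folded pair is `foldHalfDiff`. [cite: BasconesEtAl2005, Eq. (2)] -/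
theorem hybHalfDiff_fold (t t' t'' kx ky : ℝ) :
    hybHalfDiff (pavariniBand t t' t'' kx ky) (pavariniBand t t' t'' (kx + π) ky)
      = foldHalfDiff t t' kx ky := by
  rw [hybHalfDiff_def, band_eq_centre_add_halfDiff, band_add_pi_eq_centre_sub_halfDiff]
  ring

/-- `foldHalfDiff² = 4cos²kₓ (t − 2t′cos k_y)²` — the first term under Bascones' root.
[cite: BasconesEtAl2005, Eq. (2)] -/
theorem foldHalfDiff_sq (t t' kx ky : ℝ) :
    foldHalfDiff t t' kx ky ^ 2 = 4 * cos kx ^ 2 * (t - 2 * t' * cos ky) ^ 2 := by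
  unfold foldHalfDiff
  ring

/-- The two-level RADIUS of the folded pair with coupling `V/2` is Bascones' square root.
[cite: BasconesEtAl2005, Eq. (2)] -/
theorem hybRadius_fold (t t' t'' V kx ky : ℝ) :
    hybRadius (pavariniBand t t' t'' kx ky) (pavariniBand t t' t'' (kx + π) ky) (V / 2)
      = foldRadius t t' V kx ky := by
  rw [hybRadius, hybHalfDiff_fold, foldHalfDiff_sq, foldRadius]
  congr 1
  ring

/-- `0 ≤ foldRadius`. [cite: BasconesEtAl2005, Eq. (2)] -/
theorem foldRadius_nonneg (t t' V kx ky : ℝ) : 0 ≤ foldRadius t t' V kx ky := Real.sqrt_nonneg _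

/-- `foldRadius² = 4cos²kₓ (t − 2t′cos k_y)² + V²/4`. [cite: BasconesEtAl2005, Eq. (2)] -/
theorem foldRadius_sq (t t' V kx ky : ℝ) :
    foldRadius t t' V kx ky ^ 2 = 4 * cos kx ^ 2 * (t - 2 * t' * cos ky) ^ 2 + V ^ 2 / 4 :=
  Real.sq_sqrt (by positivity)

/-- A uniform diagonal shift moves the two-level mean by the shift. [cite: BasconesEtAl2005, Eq. (2)
(the additive `−μ ± t⊥(k)`)] -/
theorem hybMean_shift (e₁ e₂ a : ℝ) : hybMean (e₁ + a) (e₂ + a) = hybMean e₁ e₂ + a := by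
  unfold hybMean
  ring

/-- A uniform diagonal shift leaves the half-difference unchanged. [cite: BasconesEtAl2005, Eq. (2)] -/
theorem hybHalfDiff_shift (e₁ e₂ a : ℝ) : hybHalfDiff (e₁ + a) (e₂ + a) = hybHalfDiff e₁ e₂ := by
  unfold hybHalfDiff
  ring

/-- A uniform diagonal shift leaves the radius unchanged. [cite: BasconesEtAl2005, Eq. (2)] -/
theorem hybRadius_shift (e₁ e₂ a Δ : ℝ) : hybRadius (e₁ + a) (e₂ + a) Δ = hybRadius e₁ e₂ Δ := by
  rw [hybRadius, hybRadius, hybHalfDiff_shift]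

/-! ## §2 Eq. (2): the folded bands are the hybridised levels of the column-potential problem -/

/-- The ortho-II Bloch matrix at `k` in the basis `(k, k+Q)`: bare levels `ε(k) + a`, `ε(k+Q) + a`
(`a = −μ ± t⊥(k)`), coupled by half the column potential, `V/2`.
[cite: BasconesEtAl2005, p. 2 (the external potential `V Σ c†_{2i} c_{2i}` on every second column)] -/
def orthoBloch (t t' t'' V a kx ky : ℝ) : Matrix (Fin 2) (Fin 2) ℝ :=
  hybBloch (pavariniBand t t' t'' kx ky + a) (pavariniBand t t' t'' (kx + π) ky + a) (V / 2)

/-- Unfolding of `orthoBloch`. [cite: BasconesEtAl2005, p. 2] -/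
theorem orthoBloch_def (t t' t'' V a kx ky : ℝ) :
    orthoBloch t t' t'' V a kx ky
      = !![pavariniBand t t' t'' kx ky + a, V / 2; V / 2, pavariniBand t t' t'' (kx + π) ky + a] := rfl

/-- **Upper folded band**, Eq. (2) with the second sign `+`:
`foldCentre − μ + s + foldRadius` (`s` stands for `± t⊥(k)`). [cite: BasconesEtAl2005, Eq. (2)] -/
def bandHi (t t' t'' V μ s kx ky : ℝ) : ℝ :=
  foldCentre t t'' kx ky - μ + s + foldRadius t t' V kx ky

/-- **Lower folded band**, Eq. (2) with the second sign `−`: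
`foldCentre − μ + s − foldRadius`. [cite: BasconesEtAl2005, Eq. (2)] -/
def bandLo (t t' t'' V μ s kx ky : ℝ) : ℝ :=
  foldCentre t t'' kx ky - μ + s - foldRadius t t' V kx ky

/-- Unfolding of `bandHi` (Eq. (2) written out). [cite: BasconesEtAl2005, Eq. (2)] -/
theorem bandHi_def (t t' t'' V μ s kx ky : ℝ) :
    bandHi t t' t'' V μ s kx ky
      = -2 * t * cos ky - 2 * t'' * (cos (2 * kx) + cos (2 * ky)) - μ + s
          + Real.sqrt (4 * cos kx ^ 2 * (t - 2 * t' * cos ky) ^ 2 + V ^ 2 / 4) := rfl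

/-- Unfolding of `bandLo` (Eq. (2) written out). [cite: BasconesEtAl2005, Eq. (2)] -/
theorem bandLo_def (t t' t'' V μ s kx ky : ℝ) :
    bandLo t t' t'' V μ s kx ky
      = -2 * t * cos ky - 2 * t'' * (cos (2 * kx) + cos (2 * ky)) - μ + s
          - Real.sqrt (4 * cos kx ^ 2 * (t - 2 * t' * cos ky) ^ 2 + V ^ 2 / 4) := rfl

/-- **Eq. (2), upper sign, is the upper hybridised level** of the shifted column-potential problem.
[cite: BasconesEtAl2005, Eq. (2)] -/
theorem bandHi_eq_hybUpper (t t' t'' V μ s kx ky : ℝ) :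
    bandHi t t' t'' V μ s kx ky
      = hybUpper (pavariniBand t t' t'' kx ky + (s - μ)) (pavariniBand t t' t'' (kx + π) ky + (s - μ))
          (V / 2) := by
  rw [hybUpper, hybMean_shift, hybRadius_shift, hybMean_fold, hybRadius_fold, bandHi]
  ring

/-- **Eq. (2), lower sign, is the lower hybridised level** of the shifted column-potential problem.
[cite: BasconesEtAl2005, Eq. (2)] -/
theorem bandLo_eq_hybLower (t t' t'' V μ s kx ky : ℝ) :
    bandLo t t' t'' V μ s kx ky
      = hybLower (pavariniBand t t' t'' kx ky + (s - μ)) (pavariniBand t t' t'' (kx + π) ky + (s - μ))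
          (V / 2) := by
  rw [hybLower, hybMean_shift, hybRadius_shift, hybMean_fold, hybRadius_fold, bandLo]
  ring

/-- `E` is an eigenvalue of the ortho-II Bloch matrix (a root of its characteristic polynomial) iff
`E` is one of the two folded bands of Eq. (2). [cite: BasconesEtAl2005, Eq. (2)] -/
theorem ortho_charpoly_root_iff (t t' t'' V μ s kx ky E : ℝ) :
    (E - (pavariniBand t t' t'' kx ky + (s - μ))) * (E - (pavariniBand t t' t'' (kx + π) ky + (s - μ)))
        - (V / 2) ^ 2 = 0
      ↔ E = bandHi t t' t'' V μ s kx ky ∨ E = bandLo t t' t'' V μ s kx ky := by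
  rw [hyb_charpoly_root_iff, ← bandHi_eq_hybUpper, ← bandLo_eq_hybLower]

/-- Eigen-equation of the upper folded band, eigenvector `(V/2, foldRadius − foldHalfDiff)` in the
basis `(k, k+Q)`. [cite: BasconesEtAl2005, Eq. (2)] -/
theorem orthoBloch_mulVec_hi (t t' t'' V μ s kx ky : ℝ) :
    orthoBloch t t' t'' V (s - μ) kx ky *ᵥ ![V / 2, foldRadius t t' V kx ky - foldHalfDiff t t' kx ky]
      = bandHi t t' t'' V μ s kx ky • ![V / 2, foldRadius t t' V kx ky - foldHalfDiff t t' kx ky] := by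
  have h := hybBloch_mulVec_upper' (pavariniBand t t' t'' kx ky + (s - μ))
    (pavariniBand t t' t'' (kx + π) ky + (s - μ)) (V / 2)
  rw [hybRadius_shift, hybHalfDiff_shift, hybRadius_fold, hybHalfDiff_fold, ← bandHi_eq_hybUpper] at h
  exact h

/-- Eigen-equation of the lower folded band, eigenvector `(V/2, −(foldRadius + foldHalfDiff))`.
[cite: BasconesEtAl2005, Eq. (2)] -/
theorem orthoBloch_mulVec_lo (t t' t'' V μ s kx ky : ℝ) :
    orthoBloch t t' t'' V (s - μ) kx ky
        *ᵥ ![V / 2, -(foldRadius t t' V kx ky + foldHalfDiff t t' kx ky)]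
      = bandLo t t' t'' V μ s kx ky • ![V / 2, -(foldRadius t t' V kx ky + foldHalfDiff t t' kx ky)] := by
  have h := hybBloch_mulVec_lower' (pavariniBand t t' t'' kx ky + (s - μ))
    (pavariniBand t t' t'' (kx + π) ky + (s - μ)) (V / 2)
  rw [hybRadius_shift, hybHalfDiff_shift, hybRadius_fold, hybHalfDiff_fold, ← bandLo_eq_hybLower] at h
  exact h

/-- The centre of the folded pair does not contain `V`: `bandHi + bandLo = 2(foldCentre − μ + s)`
(trace identity). [cite: BasconesEtAl2005, Eq. (2)] -/
theorem bandHi_add_bandLo (t t' t'' V μ s kx ky : ℝ) :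
    bandHi t t' t'' V μ s kx ky + bandLo t t' t'' V μ s kx ky = 2 * (foldCentre t t'' kx ky - μ + s) := by
  unfold bandHi bandLo
  ring

/-! ## §3 The inter-branch splitting: `≥ |V|`, `= |V|` on X–S, independent of `t⊥`, `t″`, `μ` -/

/-- **The splitting of the two folded branches is `2·foldRadius`** — it contains neither `t⊥` (`s`),
nor `t″`, nor `μ` ("LDA calculations show a k-dependent α(β) splitting … independent of the bilayer
band"). [cite: BasconesEtAl2005, p. 2 and Eq. (2)] -/
theorem splitting (t t' t'' V μ s kx ky : ℝ) :
    bandHi t t' t'' V μ s kx ky - bandLo t t' t'' V μ s kx ky = 2 * foldRadius t t' V kx ky := by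
  unfold bandHi bandLo
  ring

/-- The splitting is the same for the bonding and the antibonding bilayer partner and for any `t″, μ`.
[cite: BasconesEtAl2005, p. 2 ("independent of the bilayer band")] -/
theorem splitting_indep (t t' t''₁ t''₂ V μ₁ μ₂ s₁ s₂ kx ky : ℝ) :
    bandHi t t' t''₁ V μ₁ s₁ kx ky - bandLo t t' t''₁ V μ₁ s₁ kx ky
      = bandHi t t' t''₂ V μ₂ s₂ kx ky - bandLo t t' t''₂ V μ₂ s₂ kx ky := by
  rw [splitting, splitting]

/-- `|V|/2 ≤ foldRadius` (level repulsion). [cite: BasconesEtAl2005, Eq. (2)] -/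
theorem half_abs_le_foldRadius (t t' V kx ky : ℝ) : |V| / 2 ≤ foldRadius t t' V kx ky := by
  have h0 : 0 ≤ 4 * cos kx ^ 2 * (t - 2 * t' * cos ky) ^ 2 := by positivity
  calc |V| / 2 = |V / 2| := by rw [abs_div, abs_two]
    _ = Real.sqrt ((V / 2) ^ 2) := (Real.sqrt_sq_eq_abs _).symm
    _ ≤ foldRadius t t' V kx ky := by
        rw [foldRadius]
        exact Real.sqrt_le_sqrt (by linarith)

/-- **The folding gap is at least `|V|` everywhere.** [cite: BasconesEtAl2005, p. 3 ("The minimum energy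
for the transition … is ω = V")] -/
theorem splitting_ge (t t' t'' V μ s kx ky : ℝ) :
    |V| ≤ bandHi t t' t'' V μ s kx ky - bandLo t t' t'' V μ s kx ky := by
  rw [splitting]
  linarith [half_abs_le_foldRadius t t' V kx ky]

/-- On the reduced-zone boundary `cos kₓ = 0` the radius is `|V|/2`. [cite: BasconesEtAl2005, abstract
("a gap opening at the new Brillouin zone boundary kₓ = ±π/2")] -/
theorem foldRadius_zone_boundary (t t' V kx ky : ℝ) (h : cos kx = 0) :
    foldRadius t t' V kx ky = |V| / 2 := by
  have e : 4 * (0:ℝ) ^ 2 * (t - 2 * t' * cos ky) ^ 2 + V ^ 2 / 4 = (V / 2) ^ 2 := by ring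
  rw [foldRadius, h, e, Real.sqrt_sq_eq_abs, abs_div, abs_two]

/-- **On the reduced-zone boundary the folding gap EQUALS `|V|`**, for every `k_y`, `t`, `t′`, `t″`,
`μ`, `t⊥`. [cite: BasconesEtAl2005, abstract and p. 3 ("onset … ω = V = 120 meV … corresponds to the
states with kₓ = ±π/2")] -/
theorem splitting_zone_boundary (t t' t'' V μ s kx ky : ℝ) (h : cos kx = 0) :
    bandHi t t' t'' V μ s kx ky - bandLo t t' t'' V μ s kx ky = |V| := by
  rw [splitting, foldRadius_zone_boundary t t' V kx ky h]
  ring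

/-- The X–S line of the ortho-II zone is `kₓ = π/2` (`X = (π/2, 0)`, `S = (π/2, π)`): there the gap is
`|V|`. [cite: BasconesEtAl2005, Fig. 1 caption and p. 3] -/
theorem splitting_XS (t t' t'' V μ s ky : ℝ) :
    bandHi t t' t'' V μ s (π / 2) ky - bandLo t t' t'' V μ s (π / 2) ky = |V| :=
  splitting_zone_boundary t t' t'' V μ s (π / 2) ky Real.cos_pi_div_two

/-- The same on the opposite boundary `kₓ = −π/2`. [cite: BasconesEtAl2005, abstract ("kₓ = ±π/2")] -/
theorem splitting_XS' (t t' t'' V μ s ky : ℝ) :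
    bandHi t t' t'' V μ s (-(π / 2)) ky - bandLo t t' t'' V μ s (-(π / 2)) ky = |V| :=
  splitting_zone_boundary t t' t'' V μ s (-(π / 2)) ky (by rw [Real.cos_neg, Real.cos_pi_div_two])

/-- The minimum `|V|` of the gap is attained (on X–S). [cite: BasconesEtAl2005, p. 3] -/
theorem splitting_min_attained (t t' t'' V μ s ky : ℝ) :
    ∃ kx : ℝ, bandHi t t' t'' V μ s kx ky - bandLo t t' t'' V μ s kx ky = |V| :=
  ⟨π / 2, splitting_XS t t' t'' V μ s ky⟩

/-- For fixed `k_y` the radius is largest on the axis `kₓ = 0` (`cos²kₓ ≤ 1`).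
[cite: BasconesEtAl2005, Eq. (2)] -/
theorem foldRadius_le_axis (t t' V kx ky : ℝ) : foldRadius t t' V kx ky ≤ foldRadius t t' V 0 ky := by
  unfold foldRadius
  apply Real.sqrt_le_sqrt
  rw [Real.cos_zero]
  nlinarith [cos_sq_le_one kx, sq_nonneg (t - 2 * t' * cos ky)]

/-- The axis value `foldRadius(kₓ = 0) = √(4(t − 2t′cos k_y)² + V²/4)`. [cite: BasconesEtAl2005, Eq. (2)] -/
theorem foldRadius_axis (t t' V ky : ℝ) :
    foldRadius t t' V 0 ky = Real.sqrt (4 * (t - 2 * t' * cos ky) ^ 2 + V ^ 2 / 4) := by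
  rw [foldRadius, Real.cos_zero]
  congr 1
  ring

/-- Hence the gap lies between `|V|` and `2√(4(t − 2t′cos k_y)² + V²/4)` on each line of fixed `k_y`.
[cite: BasconesEtAl2005, Eq. (2)] -/
theorem splitting_le_axis (t t' t'' V μ s kx ky : ℝ) :
    bandHi t t' t'' V μ s kx ky - bandLo t t' t'' V μ s kx ky
      ≤ 2 * Real.sqrt (4 * (t - 2 * t' * cos ky) ^ 2 + V ^ 2 / 4) := by
  rw [splitting, ← foldRadius_axis]
  linarith [foldRadius_le_axis t t' V kx ky]

/-! ## §4 No chain order (`V = 0`): bare folded bands that touch on X–S -/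

/-- Without the column potential the upper folded band is the larger of the two bare shifted levels.
[cite: BasconesEtAl2005, p. 2 ("Without the doubling of the unit cell both band pairs would be degenerate")] -/
theorem bandHi_noOrder (t t' t'' μ s kx ky : ℝ) :
    bandHi t t' t'' 0 μ s kx ky
      = max (pavariniBand t t' t'' kx ky) (pavariniBand t t' t'' (kx + π) ky) + (s - μ) := by
  rw [bandHi_eq_hybUpper, zero_div, hybUpper_of_coupling_zero, max_add_add_right]

/-- Without the column potential the lower folded band is the smaller of the two bare shifted levels.
[cite: BasconesEtAl2005, p. 2] -/
theorem bandLo_noOrder (t t' t'' μ s kx ky : ℝ) :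
    bandLo t t' t'' 0 μ s kx ky
      = min (pavariniBand t t' t'' kx ky) (pavariniBand t t' t'' (kx + π) ky) + (s - μ) := by
  rw [bandLo_eq_hybLower, zero_div, hybLower_of_coupling_zero, min_add_add_right]

/-- Without the column potential the two branches TOUCH on the zone boundary (no gap on X–S) — the
interband feature "should be absent in non-Ortho II phases". [cite: BasconesEtAl2005, p. 1] -/
theorem splitting_noOrder_zone_boundary (t t' t'' μ s kx ky : ℝ) (h : cos kx = 0) :
    bandHi t t' t'' 0 μ s kx ky - bandLo t t' t'' 0 μ s kx ky = 0 := by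
  rw [splitting_zone_boundary t t' t'' 0 μ s kx ky h, abs_zero]

/-- In particular on X–S. [cite: BasconesEtAl2005, p. 1] -/
theorem splitting_noOrder_XS (t t' t'' μ s ky : ℝ) :
    bandHi t t' t'' 0 μ s (π / 2) ky - bandLo t t' t'' 0 μ s (π / 2) ky = 0 :=
  splitting_noOrder_zone_boundary t t' t'' μ s (π / 2) ky Real.cos_pi_div_two

/-- Conversely a nonzero column potential opens the gap on X–S: it is `|V| > 0`.
[cite: BasconesEtAl2005, abstract] -/
theorem splitting_XS_pos (t t' t'' V μ s ky : ℝ) (hV : V ≠ 0) :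
    0 < bandHi t t' t'' V μ s (π / 2) ky - bandLo t t' t'' V μ s (π / 2) ky := by
  rw [splitting_XS]
  exact abs_pos.mpr hV

/-! ## §5 The bilayer term: `A`–`B` splitting `2t⊥`, independent of `V` -/

/-- The bilayer (first-sign) splitting of the UPPER folded branch is `2t⊥(k)`, whatever `V`.
[cite: BasconesEtAl2005, Eq. (2) (first ± : L = A, B)] -/
theorem bilayer_splitting_hi (t t' t'' V μ tp kx ky : ℝ) :
    bandHi t t' t'' V μ tp kx ky - bandHi t t' t'' V μ (-tp) kx ky = 2 * tp := by
  unfold bandHi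
  ring

/-- The bilayer splitting of the LOWER folded branch is `2t⊥(k)` as well. [cite: BasconesEtAl2005, Eq. (2)] -/
theorem bilayer_splitting_lo (t t' t'' V μ tp kx ky : ℝ) :
    bandLo t t' t'' V μ tp kx ky - bandLo t t' t'' V μ (-tp) kx ky = 2 * tp := by
  unfold bandLo
  ring

/-- "Bilayer splitting would show up as a double edge": on X–S the four levels are
`foldCentre − μ ± t⊥ ± |V|/2`, so the two absorption onsets (A and B) both sit at `ω = |V|` in this
rigid model — the double edge of the paper comes from the superconducting gap, not from Eq. (2).
Here: both bilayer partners have the same X–S gap. [cite: BasconesEtAl2005, abstract and p. 3] -/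
theorem splitting_XS_both_partners (t t' t'' V μ tp ky : ℝ) :
    bandHi t t' t'' V μ tp (π / 2) ky - bandLo t t' t'' V μ tp (π / 2) ky
      = bandHi t t' t'' V μ (-tp) (π / 2) ky - bandLo t t' t'' V μ (-tp) (π / 2) ky := by
  rw [splitting_XS, splitting_XS]

/-! ## §6 Eq. (3): the d-wave gap in the folded basis -/

/-- The deformation factor `g(k) = 2cos kₓ(t − 2t′cos k_y)/√(4cos²kₓ(t − 2t′cos k_y)² + V²/4)` of
Eq. (3). [cite: BasconesEtAl2005, Eq. (3)] -/
def gapFactor (t t' V kx ky : ℝ) : ℝ :=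
  2 * cos kx * (t - 2 * t' * cos ky) / foldRadius t t' V kx ky

/-- The folded-basis d-wave gap `Δ_{α,β}(k) = ½Δ₀(g(k) cos kₓ − cos k_y)`. [cite: BasconesEtAl2005, Eq. (3)] -/
def foldGap (Δ₀ t t' V kx ky : ℝ) : ℝ :=
  Δ₀ / 2 * (gapFactor t t' V kx ky * cos kx - cos ky)

/-- Unfolding of `gapFactor`. [cite: BasconesEtAl2005, Eq. (3)] -/
theorem gapFactor_def (t t' V kx ky : ℝ) :
    gapFactor t t' V kx ky
      = 2 * cos kx * (t - 2 * t' * cos ky)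
          / Real.sqrt (4 * cos kx ^ 2 * (t - 2 * t' * cos ky) ^ 2 + V ^ 2 / 4) := rfl

/-- Unfolding of `foldGap`. [cite: BasconesEtAl2005, Eq. (3)] -/
theorem foldGap_def (Δ₀ t t' V kx ky : ℝ) :
    foldGap Δ₀ t t' V kx ky = Δ₀ / 2 * (gapFactor t t' V kx ky * cos kx - cos ky) := rfl

/-- The numerator of `g` is bounded by the radius: `|2cos kₓ(t − 2t′cos k_y)| ≤ foldRadius`.
[cite: BasconesEtAl2005, Eq. (3)] -/
theorem abs_num_le_foldRadius (t t' V kx ky : ℝ) :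
    |2 * cos kx * (t - 2 * t' * cos ky)| ≤ foldRadius t t' V kx ky := by
  unfold foldRadius
  apply Real.abs_le_sqrt
  nlinarith [sq_nonneg V]

/-- **`|g(k)| ≤ 1`**: the folded gap is a genuine interpolation between the `k` and `k+Q` d-wave forms.
[cite: BasconesEtAl2005, Eq. (3)] -/
theorem abs_gapFactor_le_one (t t' V kx ky : ℝ) : |gapFactor t t' V kx ky| ≤ 1 := by
  unfold gapFactor
  rcases eq_or_lt_of_le (foldRadius_nonneg t t' V kx ky) with h | h
  · rw [← h, div_zero, abs_zero]
    exact zero_le_one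
  · rw [abs_div, abs_of_pos h, div_le_one h]
    exact abs_num_le_foldRadius t t' V kx ky

/-- On the zone boundary `g = 0`: there the folded gap is `−½Δ₀ cos k_y` ("The breaking of the
tetragonal symmetry shifts slightly the position of the nodes"). [cite: BasconesEtAl2005, Eq. (3) and p. 2] -/
theorem gapFactor_zone_boundary (t t' V kx ky : ℝ) (h : cos kx = 0) : gapFactor t t' V kx ky = 0 := by
  unfold gapFactor
  rw [h]
  simp

/-- The folded gap on the zone boundary. [cite: BasconesEtAl2005, Eq. (3)] -/
theorem foldGap_zone_boundary (Δ₀ t t' V kx ky : ℝ) (h : cos kx = 0) :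
    foldGap Δ₀ t t' V kx ky = -(Δ₀ / 2) * cos ky := by
  unfold foldGap
  rw [gapFactor_zone_boundary t t' V kx ky h]
  ring

/-- Without chain order, on the part of the zone where `2cos kₓ(t − 2t′cos k_y) > 0`, `g = 1`.
[cite: BasconesEtAl2005, Eq. (3)] -/
theorem gapFactor_noOrder_pos (t t' kx ky : ℝ) (hpos : 0 < 2 * cos kx * (t - 2 * t' * cos ky)) :
    gapFactor t t' 0 kx ky = 1 := by
  have e : 4 * cos kx ^ 2 * (t - 2 * t' * cos ky) ^ 2 + (0:ℝ) ^ 2 / 4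
      = (2 * cos kx * (t - 2 * t' * cos ky)) ^ 2 := by ring
  unfold gapFactor foldRadius
  rw [e, Real.sqrt_sq hpos.le, div_self hpos.ne']

/-- … and there the folded gap IS the plain d-wave gap `½Δ₀(cos kₓ − cos k_y)`.
[cite: BasconesEtAl2005, Eq. (3) and p. 2 (the `V₀(cos kₓ − cos k_y)(cos kₓ′ − cos k_y′)` pairing)] -/
theorem foldGap_noOrder_pos (Δ₀ t t' kx ky : ℝ) (hpos : 0 < 2 * cos kx * (t - 2 * t' * cos ky)) :
    foldGap Δ₀ t t' 0 kx ky = Δ₀ / 2 * (cos kx - cos ky) := by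
  unfold foldGap
  rw [gapFactor_noOrder_pos t t' kx ky hpos, one_mul]

/-- Without chain order, where `2cos kₓ(t − 2t′cos k_y) < 0`, `g = −1`. [cite: BasconesEtAl2005, Eq. (3)] -/
theorem gapFactor_noOrder_neg (t t' kx ky : ℝ) (hneg : 2 * cos kx * (t - 2 * t' * cos ky) < 0) :
    gapFactor t t' 0 kx ky = -1 := by
  have e : 4 * cos kx ^ 2 * (t - 2 * t' * cos ky) ^ 2 + (0:ℝ) ^ 2 / 4
      = (-(2 * cos kx * (t - 2 * t' * cos ky))) ^ 2 := by ring
  unfold gapFactor foldRadius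
  rw [e, Real.sqrt_sq (by linarith), div_neg, div_self hneg.ne]

/-- … and there the folded gap is the d-wave gap of the PARTNER `k + Q`:
`½Δ₀(cos(kₓ + π) − cos k_y)`. [cite: BasconesEtAl2005, Eq. (3)] -/
theorem foldGap_noOrder_neg (Δ₀ t t' kx ky : ℝ) (hneg : 2 * cos kx * (t - 2 * t' * cos ky) < 0) :
    foldGap Δ₀ t t' 0 kx ky = Δ₀ / 2 * (cos (kx + π) - cos ky) := by
  unfold foldGap
  rw [gapFactor_noOrder_neg t t' kx ky hneg, Real.cos_add_pi]
  ring

/-! ## §7 Eqs. (5), (6): the interband optical matrix elements -/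

/-- `M_aa(k) = V²(t − 2t′cos k_y)² sin²kₓ / (4cos²kₓ(t − 2t′cos k_y)² + V²/4)`. [cite: BasconesEtAl2005, Eq. (5)] -/
def mAA (t t' V kx ky : ℝ) : ℝ :=
  V ^ 2 * (t - 2 * t' * cos ky) ^ 2 * sin kx ^ 2 / (4 * cos kx ^ 2 * (t - 2 * t' * cos ky) ^ 2 + V ^ 2 / 4)

/-- `M_bb(k) = 4V² t′² sin²k_y cos²kₓ / (4cos²kₓ(t − 2t′cos k_y)² + V²/4)`. [cite: BasconesEtAl2005, Eq. (6)] -/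
def mBB (t t' V kx ky : ℝ) : ℝ :=
  4 * V ^ 2 * t' ^ 2 * sin ky ^ 2 * cos kx ^ 2 / (4 * cos kx ^ 2 * (t - 2 * t' * cos ky) ^ 2 + V ^ 2 / 4)

/-- Unfolding of `mAA`. [cite: BasconesEtAl2005, Eq. (5)] -/
theorem mAA_def (t t' V kx ky : ℝ) :
    mAA t t' V kx ky = V ^ 2 * (t - 2 * t' * cos ky) ^ 2 * sin kx ^ 2
      / (4 * cos kx ^ 2 * (t - 2 * t' * cos ky) ^ 2 + V ^ 2 / 4) := rfl

/-- Unfolding of `mBB`. [cite: BasconesEtAl2005, Eq. (6)] -/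
theorem mBB_def (t t' V kx ky : ℝ) :
    mBB t t' V kx ky = 4 * V ^ 2 * t' ^ 2 * sin ky ^ 2 * cos kx ^ 2
      / (4 * cos kx ^ 2 * (t - 2 * t' * cos ky) ^ 2 + V ^ 2 / 4) := rfl

/-- The common denominator is `foldRadius²`. [cite: BasconesEtAl2005, Eqs. (2), (5), (6)] -/
theorem mAA_eq_div_foldRadius_sq (t t' V kx ky : ℝ) :
    mAA t t' V kx ky = V ^ 2 * (t - 2 * t' * cos ky) ^ 2 * sin kx ^ 2 / foldRadius t t' V kx ky ^ 2 := by
  rw [mAA, foldRadius_sq]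

/-- `M_aa ≥ 0`. [cite: BasconesEtAl2005, Eq. (5)] -/
theorem mAA_nonneg (t t' V kx ky : ℝ) : 0 ≤ mAA t t' V kx ky := by
  unfold mAA
  positivity

/-- `M_bb ≥ 0`. [cite: BasconesEtAl2005, Eq. (6)] -/
theorem mBB_nonneg (t t' V kx ky : ℝ) : 0 ≤ mBB t t' V kx ky := by
  unfold mBB
  positivity

/-- **No chain order, no interband absorption**: `M_aa = 0` when `V = 0` ("These features should be
absent in non-Ortho II phases"). [cite: BasconesEtAl2005, p. 1 and Eq. (5)] -/
theorem mAA_noOrder (t t' kx ky : ℝ) : mAA t t' 0 kx ky = 0 := by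
  unfold mAA
  simp

/-- `M_bb = 0` when `V = 0`. [cite: BasconesEtAl2005, p. 1 and Eq. (6)] -/
theorem mBB_noOrder (t t' kx ky : ℝ) : mBB t t' 0 kx ky = 0 := by
  unfold mBB
  simp

/-- **`M_bb` vanishes on the zone boundary** ("M_bb(k) vanishes at kₓ = ±π/2, resulting in a vanishing
σ_bb(ω) at the threshold frequency"). [cite: BasconesEtAl2005, p. 3 and Eq. (6)] -/
theorem mBB_zone_boundary (t t' V kx ky : ℝ) (h : cos kx = 0) : mBB t t' V kx ky = 0 := by
  unfold mBB
  rw [h]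
  simp

/-- On X–S, `M_bb = 0`. [cite: BasconesEtAl2005, p. 3] -/
theorem mBB_XS (t t' V ky : ℝ) : mBB t t' V (π / 2) ky = 0 :=
  mBB_zone_boundary t t' V (π / 2) ky Real.cos_pi_div_two

/-- **`M_aa` on the zone boundary is `4(t − 2t′cos k_y)² sin²kₓ`** (for `V ≠ 0`) — "finite and large at
kₓ = ±π/2". [cite: BasconesEtAl2005, p. 3 and Eq. (5)] -/
theorem mAA_zone_boundary (t t' V kx ky : ℝ) (h : cos kx = 0) (hV : V ≠ 0) :
    mAA t t' V kx ky = 4 * (t - 2 * t' * cos ky) ^ 2 * sin kx ^ 2 := by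
  have e : 4 * (0:ℝ) ^ 2 * (t - 2 * t' * cos ky) ^ 2 + V ^ 2 / 4 = V ^ 2 / 4 := by ring
  unfold mAA
  rw [h, e]
  field_simp

/-- On X–S, `M_aa = 4(t − 2t′cos k_y)²` (as `sin²(π/2) = 1`). [cite: BasconesEtAl2005, p. 3] -/
theorem mAA_XS (t t' V ky : ℝ) (hV : V ≠ 0) : mAA t t' V (π / 2) ky = 4 * (t - 2 * t' * cos ky) ^ 2 := by
  rw [mAA_zone_boundary t t' V (π / 2) ky Real.cos_pi_div_two hV, Real.sin_pi_div_two]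
  ring

/-- `M_bb` also vanishes on the line `sin k_y = 0`. [cite: BasconesEtAl2005, Eq. (6)] -/
theorem mBB_ky_axis (t t' V kx ky : ℝ) (h : sin ky = 0) : mBB t t' V kx ky = 0 := by
  unfold mBB
  rw [h]
  simp

/-! ## §8 Eq. (2) with the paper's `k`-dependent column potential `V(k)`

"Since in LDA calculations `V` and `t⊥(k)` are only slightly `k`-dependent near the nodes, we set them
constant" [BasconesEtAl2005, p. 2]: the column potential of Eq. (2) is in general a function `V(k)`.
The exact one-body instance recorded here is the one the cell reads its Wannier objects with: a column
whose on-site energy differs from its neighbour's by `V` AND whose `b`-axis hopping differs by `2δ`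
(`t_y = t̄_y ± δ`) has, at fixed `k_y`, the column-alternating one-body energy `V − 4δ cos k_y`
(each column's `b`-band being `−2t_y cos k_y`), i.e. Eq. (2) with `V ↦ V(k_y) = V − 4δ cos k_y`,
coupling `V(k_y)/2`.  Everything below is Eq. (2)'s two-level algebra at the zone boundary, where the two
bare levels coincide (`band_add_pi_zone_boundary`). -/

/-- The coupling `V(k_y)/2 = V/2 − 2δ cos k_y` of Eq. (2) with a `k_y`-dependent column potential
`V(k_y) = V − 4δ cos k_y` (site difference `V`, `b`-hopping difference `2δ` between the two kinds of
column). [cite: BasconesEtAl2005, Eq. (2) and p. 2 («V and t⊥(k) are only slightly k-dependent … we set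
them constant»)] -/
def siteBondCoupling (V δ ky : ℝ) : ℝ := V / 2 - 2 * δ * cos ky

/-- Unfolding of `siteBondCoupling`. [cite: BasconesEtAl2005, Eq. (2) and p. 2] -/
theorem siteBondCoupling_def (V δ ky : ℝ) : siteBondCoupling V δ ky = V / 2 - 2 * δ * cos ky := rfl

/-- Without bond alternation the coupling is Bascones' `V/2`. [cite: BasconesEtAl2005, p. 2] -/
theorem siteBondCoupling_bond_zero (V ky : ℝ) : siteBondCoupling V 0 ky = V / 2 := by
  unfold siteBondCoupling
  ring

/-- **X–S gap of Eq. (2) with `V(k_y)`**: on the zone boundary the two bare levels coincide (`e = ε(k) =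
ε(k+Q)`, `band_add_pi_zone_boundary`), and the gap of the two-level problem with coupling `V(k_y)/2` is
`|V(k_y)| = |V − 4δ cos k_y|` — the `k`-dependent splitting «between 120 and 160 meV» on X–S of the
paper's LDA is such a `V(k)`. [cite: BasconesEtAl2005, Eq. (2) and p. 2] -/
theorem splitting_XS_siteBond (e V δ ky : ℝ) :
    hybUpper e e (siteBondCoupling V δ ky) - hybLower e e (siteBondCoupling V δ ky)
      = |V - 4 * δ * cos ky| := by
  rw [hyb_splitting, hybRadius_of_levels_eq, siteBondCoupling,
    show V / 2 - 2 * δ * cos ky = (V - 4 * δ * cos ky) / 2 by ring, abs_div, abs_two]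
  ring

/-- With `δ = 0` the X–S gap is the constant `|V|` (Bascones' case). [cite: BasconesEtAl2005, p. 3] -/
theorem splitting_XS_siteBond_zero (e V ky : ℝ) :
    hybUpper e e (siteBondCoupling V 0 ky) - hybLower e e (siteBondCoupling V 0 ky) = |V| := by
  rw [splitting_XS_siteBond]
  simp

/-- Upper bound of the X–S gap of Eq. (2) with `V(k_y) = V − 4δ cos k_y`: `≤ |V| + 4|δ|`.
[cite: BasconesEtAl2005, Eq. (2) and p. 2] -/
theorem siteBond_gap_le (V δ ky : ℝ) : |V - 4 * δ * cos ky| ≤ |V| + 4 * |δ| := by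
  have h1 : |4 * δ * cos ky| ≤ 4 * |δ| := by
    rw [abs_mul, abs_mul, abs_of_pos (by norm_num : (0:ℝ) < 4)]
    have hc := abs_cos_le_one ky
    have hδ := abs_nonneg δ
    nlinarith
  calc |V - 4 * δ * cos ky| ≤ |V| + |4 * δ * cos ky| := abs_sub _ _
    _ ≤ |V| + 4 * |δ| := by linarith

/-- Lower bound of the X–S gap of Eq. (2) with `V(k_y) = V − 4δ cos k_y`: `≥ |V| − 4|δ|`.
[cite: BasconesEtAl2005, Eq. (2) and p. 2] -/
theorem siteBond_gap_ge (V δ ky : ℝ) : |V| - 4 * |δ| ≤ |V - 4 * δ * cos ky| := by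
  have h1 : |4 * δ * cos ky| ≤ 4 * |δ| := by
    rw [abs_mul, abs_mul, abs_of_pos (by norm_num : (0:ℝ) < 4)]
    have hc := abs_cos_le_one ky
    have hδ := abs_nonneg δ
    nlinarith
  have h2 : |V| - |4 * δ * cos ky| ≤ |V - 4 * δ * cos ky| := abs_sub_abs_le_abs_sub _ _
  linarith

/-- The X–S gap of Eq. (2) with `V(k_y) = V − 4δ cos k_y` takes the values `|V − 4δ|` at X (`k_y = 0`)
and `|V + 4δ|` at S (`k_y = π`); these are equal iff `Vδ = 0` — a gap that is CONSTANT along X–S is the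
paper's constant-`V` case, a varying one is its `k`-dependent `V(k)`. [cite: BasconesEtAl2005, Eq. (2)
and p. 2] -/
theorem splitting_XS_siteBond_varies (V δ : ℝ) :
    |V - 4 * δ * cos 0| = |V - 4 * δ * cos π| ↔ V * δ = 0 := by
  rw [Real.cos_zero, Real.cos_pi, mul_one, mul_neg_one, sub_neg_eq_add]
  constructor
  · intro h
    have h2 : (V - 4 * δ) ^ 2 = (V + 4 * δ) ^ 2 := by
      rw [← sq_abs, h, sq_abs]
    nlinarith
  · intro h
    rcases mul_eq_zero.mp h with hV | hδ
    · rw [hV, zero_sub, zero_add, abs_neg]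
    · rw [hδ]
      simp

end OrthoIIFold

end Literature.MathematicalPhysics.QuantumLattice
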